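import Literature.MathematicalPhysics.QuantumFieldTheory.Balaban1983to89.B11Eq103H1Complex
import HarnessLib

/-!
# Route `UnitScaleTilt`, crux K1 «MinimiserStabilityRegPr» (stmt-QuantumFields-19200), route-R E′ (N06) LANE II «DIVERGENCE RECOVERY AT CURVED W» (★★OWNER RULING №23), brick
# (C5-a) «LIFT TO A COVER» (★p1 g19 skeleton v1.2 §5, NAMER WORD №1 «(C5-a) → px12 g7»), FILE F1 of px12 g7's LOCATE `LOCATE-C5a-COVERLIFT-px12g7.md` §2:
# **ORTHOGONAL PROJECTIONS — AND PRINT'S GAUGE PROJECTOR `R = projR Δ Q′` ((3.21)) — INTERTWINE WITH A PULLBACK WHOSE ADJOINT PUSHFORWARD RESPECTS `Δ` AND `ker Q′`**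
# (the `RCLike`∕complex twin of the H lane's ✓`CoverFlatOps.starProjection_intertwine_of_push`, `UnitScaleTiltCoverAdjoint.lean`, which is stated over `ℝ`)

Cell `ym3-torus` (HUMAN RULING D-0037, YM ladder rung R3 — YM₃ on T³ is a rung, NOT d = 4, NOT infinite volume, NOT a mass gap, NOT Clay; YM gap NOT proved), width seat
`ym3-torus-px12` (gen 7).  THEOREMS ONLY (0 `def`, 0 `sorry`); `--supports stmt-QuantumFields-19200 --as helper`; count-neutral; Mathlib + lit `B11Eq103H1Complex.projR` only (generic,
consumer-independent).  Nothing here is a claim about (V3), `hN06`, the stub, the crux or any summit statement.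

WHY.  Lane II's divergence-recovery row ((V3) = ✓`Prop7HcoOfDivRecovery.hCo_of_divRecovery`'s `hRec`) displays `‖RcombL2 W (DstarL2 W y)‖²` with
`RcombL2 W = projR (covLapSite W) (QprimeCombL2 W)` (✓`Prop7QprimeCombL2.RcombL2_eq_projR`), the orthogonal projection onto `Δ_W(ker Q′_W)` ([Balaban1985BackgroundPropagators] (3.21)).
(C5-a) transfers the row from the `L^{jc}`-fold cover member `F.cover jc` (✓`CoverSites`) to a small member `F` term by term; for the projector term this needs
`projR Δ′ Q″ (π* v) = π* (projR Δ Q′ v)` for the `ℓ²` pullback `π*` along the covering map.  This file is that statement in abstract Hilbert letters: if `π` has an adjoint partner `ρ`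
(`⟪π f, g⟫ = ⟪f, ρ g⟫` — the fibre sum up to the degree), `π ∘ Δ = Δ′ ∘ π`, `ρ ∘ Δ′ = Δ ∘ ρ`, `π(ker Q′) ⊆ ker Q″` and `ρ(ker Q″) ⊆ ker Q′`, then `projR Δ′ Q″ ∘ π = π ∘ projR Δ Q′`.
The four hypotheses are discharged in the member letters by files F2∕F3 of the LOCATE (naturality of `covLapSite` and of the comb site average `QprimeCombL2` under pullback and fibre sum).

WHAT IS PROVED (any `RCLike 𝕜`, inner product spaces; ns `…Theorems.Prop7ProjRPullbackIntertwine`):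
* §1 `mem_orthogonal_map_of_push` (`ρ(K′) ⊆ K ⇒ π(Kᗮ) ⊆ K′ᗮ`), ★ `starProjection_intertwine` (`π(K) ⊆ K′`, `π(Kᗮ) ⊆ K′ᗮ ⇒ P_{K′}(π v) = π(P_K v)`),
  ★ `starProjection_intertwine_of_push` (the complement condition from the pushforward) — verbatim `𝕜`-twins of ✓`CoverFlatOps` (ℝ);
* §2 ★★ `projR_intertwine_of_push` — the corollary for lit `B11Eq103H1Complex.projR Δs Q′ = ((ker Q′).map Δs).starProjection`: the two `map`ped kernels are intertwined by `π` and `ρ`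
  under the four hypotheses above; `projR_apply_eq_starProjection` (unfolding, any `HasOrthogonalProjection` instance).
HONEST SCOPE.  Linear algebra; no lattice, no estimate.  References: T. Bałaban, CMP 99 (1985) 389–434 [Balaban1985BackgroundPropagators] ((3.20)–(3.23) p.394); CMP 96 (1984) 223–250
[Balaban1984PropagatorsII] ((2.15)–(2.19) pp.225–226 — operators on a covering torus descend∕lift).
-/

noncomputable section

open scoped InnerProductSpace

namespace Summit.QuantumFields.YangMills.Theorems.Prop7ProjRPullbackIntertwine

open Literature.MathematicalPhysics.QuantumFieldTheory.Balaban1983to89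
open B11Eq103H1Complex (projR)

variable {𝕜 : Type*} [RCLike 𝕜]
  {E₁ : Type*} [NormedAddCommGroup E₁] [InnerProductSpace 𝕜 E₁]
  {E₁' : Type*} [NormedAddCommGroup E₁'] [InnerProductSpace 𝕜 E₁']

/-! ## §1 Orthogonal projections and pullbacks with an adjoint pushforward (the `𝕜`-twin of ✓`CoverFlatOps`) -/

/-- **`ρ(K′) ⊆ K` GIVES `π(Kᗮ) ⊆ K′ᗮ`** (pullback of the orthogonal complement, via the adjoint pushforward). [cite: Balaban1984PropagatorsII, (2.16)-(2.17) p.225] -/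
theorem mem_orthogonal_map_of_push (K : Submodule 𝕜 E₁) (K' : Submodule 𝕜 E₁') (π₁ : E₁ →ₗ[𝕜] E₁') (ρ₁ : E₁' →ₗ[𝕜] E₁)
    (h₁ : ∀ (f : E₁) (g : E₁'), ⟪π₁ f, g⟫_𝕜 = ⟪f, ρ₁ g⟫_𝕜) (hρ : ∀ k' ∈ K', ρ₁ k' ∈ K) {q : E₁} (hq : q ∈ Kᗮ) :
    π₁ q ∈ K'ᗮ := by
  rw [Submodule.mem_orthogonal]
  intro k' hk'
  rw [← inner_conj_symm, h₁, inner_conj_symm]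
  exact Submodule.inner_right_of_mem_orthogonal (hρ k' hk') hq

/-- ★ **ORTHOGONAL PROJECTIONS INTERTWINE WITH A PULLBACK THAT RESPECTS THE SUBSPACE AND ITS COMPLEMENT**: `π(K) ⊆ K′`, `π(Kᗮ) ⊆ K′ᗮ` ⇒ `P_{K′}(π v) = π(P_K v)`.
[cite: Balaban1984PropagatorsII, (2.16)-(2.19) pp.225-226] -/
theorem starProjection_intertwine (K : Submodule 𝕜 E₁) (K' : Submodule 𝕜 E₁') [K.HasOrthogonalProjection] [K'.HasOrthogonalProjection]
    (π₁ : E₁ →ₗ[𝕜] E₁') (hK : ∀ k ∈ K, π₁ k ∈ K') (hKo : ∀ q ∈ Kᗮ, π₁ q ∈ K'ᗮ) (v : E₁) :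
    K'.starProjection (π₁ v) = π₁ (K.starProjection v) := by
  have hdec : π₁ v = π₁ (K.starProjection v) + π₁ (v - K.starProjection v) := by rw [← map_add, add_sub_cancel]
  have hmem : π₁ (K.starProjection v) ∈ K' := hK _ (Submodule.starProjection_apply_mem K v)
  have horth : π₁ (v - K.starProjection v) ∈ K'ᗮ := hKo _ (Submodule.sub_starProjection_mem_orthogonal v)
  rw [hdec, map_add, Submodule.starProjection_eq_self_iff.mpr hmem, (Submodule.starProjection_apply_eq_zero_iff K').mpr horth, add_zero]

/-- ★ The same with the complement condition supplied by a pushforward (`mem_orthogonal_map_of_push`): `⟪π f, g⟫ = ⟪f, ρ g⟫`, `π(K) ⊆ K′`, `ρ(K′) ⊆ K` ⇒ `P_{K′}(π v) = π(P_K v)`.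
[cite: Balaban1984PropagatorsII, (2.16)-(2.19) pp.225-226] -/
theorem starProjection_intertwine_of_push (K : Submodule 𝕜 E₁) (K' : Submodule 𝕜 E₁') [K.HasOrthogonalProjection] [K'.HasOrthogonalProjection]
    (π₁ : E₁ →ₗ[𝕜] E₁') (ρ₁ : E₁' →ₗ[𝕜] E₁) (h₁ : ∀ (f : E₁) (g : E₁'), ⟪π₁ f, g⟫_𝕜 = ⟪f, ρ₁ g⟫_𝕜)
    (hK : ∀ k ∈ K, π₁ k ∈ K') (hρ : ∀ k' ∈ K', ρ₁ k' ∈ K) (v : E₁) :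
    K'.starProjection (π₁ v) = π₁ (K.starProjection v) :=
  starProjection_intertwine K K' π₁ hK (fun _ hq => mem_orthogonal_map_of_push K K' π₁ ρ₁ h₁ hρ hq) v

/-! ## §2 Print's gauge projector `R = projR Δ Q′` ((3.21)) under a pullback -/

section ProjR

variable [FiniteDimensional 𝕜 E₁] [FiniteDimensional 𝕜 E₁']
  {F₁ : Type*} [AddCommGroup F₁] [Module 𝕜 F₁] {F₁' : Type*} [AddCommGroup F₁'] [Module 𝕜 F₁']

/-- Unfolding lit `projR`: `projR Δs Q′ v = P_{(ker Q′).map Δs} v` for ANY orthogonal-projection instance on the (finite-dimensional, hence complete) subspace.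
[cite: Balaban1985BackgroundPropagators, (3.21) p.394] -/
theorem projR_apply_eq_starProjection (Δs : E₁ →ₗ[𝕜] E₁) (Q' : E₁ →ₗ[𝕜] F₁) [((LinearMap.ker Q').map Δs).HasOrthogonalProjection] (v : E₁) :
    projR Δs Q' v = ((LinearMap.ker Q').map Δs).starProjection v := rfl

/-- ★★ **`R(W′) ∘ π* = π* ∘ R(W)` — THE GAUGE PROJECTOR (3.21) INTERTWINES WITH A PULLBACK** whose adjoint pushforward `ρ` (`⟪π f, g⟫ = ⟪f, ρ g⟫`) satisfies, together with `π`: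
`π ∘ Δ = Δ′ ∘ π`, `ρ ∘ Δ′ = Δ ∘ ρ`, `π(ker Q′) ⊆ ker Q″`, `ρ(ker Q″) ⊆ ker Q′`.  Then `projR Δ′ Q″ (π v) = π (projR Δ Q′ v)`: the two ranges `Δ(ker Q′)`, `Δ′(ker Q″)` are carried into each
other by `π`, `ρ`, and §1 applies.  (For the `L^{jc}`-fold cover: `π` = the `ℓ²` pullback, `ρ` = the fibre sum, `Δ, Δ′` the covariant site Laplacians, `Q′, Q″` the comb site averages.)
[cite: Balaban1985BackgroundPropagators, (3.20)-(3.23) p.394; Balaban1984PropagatorsII, (2.18)-(2.19) p.226] -/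
theorem projR_intertwine_of_push (Δs : E₁ →ₗ[𝕜] E₁) (Δs' : E₁' →ₗ[𝕜] E₁') (Q' : E₁ →ₗ[𝕜] F₁) (Q'' : E₁' →ₗ[𝕜] F₁')
    (π₁ : E₁ →ₗ[𝕜] E₁') (ρ₁ : E₁' →ₗ[𝕜] E₁) (h₁ : ∀ (f : E₁) (g : E₁'), ⟪π₁ f, g⟫_𝕜 = ⟪f, ρ₁ g⟫_𝕜)
    (hΔ : ∀ f : E₁, π₁ (Δs f) = Δs' (π₁ f)) (hΔ' : ∀ g : E₁', ρ₁ (Δs' g) = Δs (ρ₁ g))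
    (hQ : ∀ f : E₁, Q' f = 0 → Q'' (π₁ f) = 0) (hQ' : ∀ g : E₁', Q'' g = 0 → Q' (ρ₁ g) = 0) (v : E₁) :
    projR Δs' Q'' (π₁ v) = π₁ (projR Δs Q' v) := by
  haveI : CompleteSpace ((LinearMap.ker Q').map Δs) := FiniteDimensional.complete 𝕜 _
  haveI : CompleteSpace ((LinearMap.ker Q'').map Δs') := FiniteDimensional.complete 𝕜 _
  rw [projR_apply_eq_starProjection, projR_apply_eq_starProjection]
  refine starProjection_intertwine_of_push _ _ π₁ ρ₁ h₁ ?_ ?_ v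
  · intro k hk
    obtain ⟨l, hl, rfl⟩ := Submodule.mem_map.1 hk
    rw [hΔ]
    exact Submodule.mem_map_of_mem (LinearMap.mem_ker.2 (hQ l (LinearMap.mem_ker.1 hl)))
  · intro k' hk'
    obtain ⟨l', hl', rfl⟩ := Submodule.mem_map.1 hk'
    rw [hΔ']
    exact Submodule.mem_map_of_mem (LinearMap.mem_ker.2 (hQ' l' (LinearMap.mem_ker.1 hl')))

/-- The NORM form the transfer reads: under the same hypotheses `‖projR Δ′ Q″ (π v)‖ = ‖π (projR Δ Q′ v)‖`. [cite: Balaban1985BackgroundPropagators, (3.21) p.394] -/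
theorem norm_projR_pull_eq (Δs : E₁ →ₗ[𝕜] E₁) (Δs' : E₁' →ₗ[𝕜] E₁') (Q' : E₁ →ₗ[𝕜] F₁) (Q'' : E₁' →ₗ[𝕜] F₁')
    (π₁ : E₁ →ₗ[𝕜] E₁') (ρ₁ : E₁' →ₗ[𝕜] E₁) (h₁ : ∀ (f : E₁) (g : E₁'), ⟪π₁ f, g⟫_𝕜 = ⟪f, ρ₁ g⟫_𝕜)
    (hΔ : ∀ f : E₁, π₁ (Δs f) = Δs' (π₁ f)) (hΔ' : ∀ g : E₁', ρ₁ (Δs' g) = Δs (ρ₁ g))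
    (hQ : ∀ f : E₁, Q' f = 0 → Q'' (π₁ f) = 0) (hQ' : ∀ g : E₁', Q'' g = 0 → Q' (ρ₁ g) = 0) (v : E₁) :
    ‖projR Δs' Q'' (π₁ v)‖ = ‖π₁ (projR Δs Q' v)‖ := by
  rw [projR_intertwine_of_push Δs Δs' Q' Q'' π₁ ρ₁ h₁ hΔ hΔ' hQ hQ' v]

end ProjR

end Summit.QuantumFields.YangMills.Theorems.Prop7ProjRPullbackIntertwine

end
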